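import Summits.KontsevichZagierPeriods.KontsevichZagierPeriods.Theorems.TerasomaMultiplicationGapSectorBeyondTwelveParity
import Mathlib.Algebra.Order.Floor.Ring
import Mathlib.Data.Rat.Floor

/-!
# The parity functional kills the standard Beta-symbol relators; Das's level-15 symbol survives

Companion (theorems only) of `…GapSectorBeyondTwelveParity` for item `GapSectorBeyondTwelve`
(stmt-KontsevichZagierPeriods-14858, route `TerasomaMultiplication`).  With `χ = chi` the parity
distribution and `Φ = Phi` its symbol functional `[a,b] ↦ χ(a)+χ(b)+χ(a+b)` on `ℤ[ℚ × ℚ]`: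

* `Phi_symm`, `Phi_transl`, `Phi_dirichlet`, `Phi_refl`, `Phi_unit`, `Phi_gauss` — `Φ` kills the
  six standard relator families (Gauss multiplication for EVERY `n`, by the distribution law
  `sum_chi_div` at `x = 0` and `x = n s` plus telescoping); `Phi_g12` — it kills the level-12 gap
  symbol `g₁₂ = [1/12,1/4] − [1/4,1/4]`;
* `relSpan_sup_le_ker` — hence the item's subgroup `closure(relator pairs) ⊔ ℤ·g₁₂` (copied
  VERBATIM from the route file) lies in `ker Φ`;
* `Phi_das`, `das_symbol_not_mem` — `Φ([4/15,1/5] − [1/3,2/15]) = 1`, so Das's level-15 symbol is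
  OUTSIDE that subgroup, at all levels simultaneously (the planner's integer HNF evidence covered
  levels 60 and 120);
* `das_hodge` — the Hodge-type test of the item holds for Das's pair (`u mod 15` check).

These discharge the arithmetic hypotheses of `GapSectorBeyondTwelve` for Das's pair; the
KZ-calculus consequence is drawn in `…GapSectorBeyondTwelve` (`dasFifteen_of_gapSectorBeyondTwelve`).
[Das 2000; Anderson 2002; Deligne 1982 Thm 7.18 / Koblitz–Ogus]
-/

namespace Summit.KontsevichZagierPeriods.TerasomaMultiplication.GapSectorBeyondTwelveParity

open Finset

/-! ### `Phi` kills the relator families -/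

/-- Symmetry relator: `Φ[a,b] = Φ[b,a]`. [folklore] -/
theorem Phi_symm (a b : ℚ) :
    Phi (FreeAbelianGroup.of (a, b)) = Phi (FreeAbelianGroup.of (b, a)) := by
  rw [Phi_of, Phi_of, add_comm b a]
  abel

/-- Translation relator: `Φ[a,b] = Φ[a+1,b]`. [folklore] -/
theorem Phi_transl (a b : ℚ) :
    Phi (FreeAbelianGroup.of (a, b)) = Phi (FreeAbelianGroup.of (a + 1, b)) := by
  rw [Phi_of, Phi_of, chi_add_one, show a + 1 + b = (a + b) + 1 by ring, chi_add_one]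

/-- Dirichlet re-association relator: `Φ[a,b] + Φ[a+b,c] = Φ[b,c] + Φ[a,b+c]`. [folklore] -/
theorem Phi_dirichlet (a b c : ℚ) :
    Phi (FreeAbelianGroup.of (a, b)) + Phi (FreeAbelianGroup.of (a + b, c)) =
      Phi (FreeAbelianGroup.of (b, c)) + Phi (FreeAbelianGroup.of (a, b + c)) := by
  simp only [Phi_of]
  rw [show a + (b + c) = a + b + c by ring]
  linear_combination CharTwo.add_self_eq_zero (chi (a + b)) - CharTwo.add_self_eq_zero (chi (b + c))

/-- Euler reflection relator: `Φ[a,1-a] = Φ[½,½]`. [folklore] -/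
theorem Phi_refl (a : ℚ) :
    Phi (FreeAbelianGroup.of (a, 1 - a)) = Phi (FreeAbelianGroup.of (1 / 2, 1 / 2)) := by
  simp only [Phi_of, chi_one_sub]
  rw [show a + (1 - a) = 1 by ring, show (1 / 2 : ℚ) + 1 / 2 = 1 by norm_num, chi_one,
    CharTwo.add_self_eq_zero (chi a), CharTwo.add_self_eq_zero (chi (1 / 2))]

/-- Unit relator: `Φ[1,1] = 0`. [folklore] -/
theorem Phi_unit : Phi (FreeAbelianGroup.of ((1 : ℚ), (1 : ℚ))) = 0 := by
  rw [Phi_of, chi_one, show (1 : ℚ) + 1 = (2 : ℕ) by norm_num, chi_natCast]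
  simp

/-- Telescoping in `ℤ/2`: `∑_{j<m} (g j + g (j+1)) = g 0 + g m`. [folklore] -/
theorem sum_add_succ_zmod_two (g : ℕ → ZMod 2) (m : ℕ) :
    ∑ j ∈ range m, (g j + g (j + 1)) = g 0 + g m := by
  induction m with
  | zero => simp [CharTwo.add_self_eq_zero]
  | succ m ih =>
    rw [sum_range_succ, ih]
    linear_combination CharTwo.add_self_eq_zero (g m)

/-- Gauss multiplication relator: for `n ≥ 1`,
`Φ(∑_{k<n-1}[(k+1)/n, s]) = Φ(∑_{j<n-1}[s, (j+1)s])` — by the parity distribution law applied at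
`x = 0` and `x = n s`, and telescoping. [folklore] -/
theorem Phi_gauss (n : ℕ) (hn : 1 ≤ n) (s : ℚ) :
    Phi (∑ k ∈ range (n - 1), FreeAbelianGroup.of ((((k + 1 : ℕ) : ℚ)) / n, s)) =
    Phi (∑ j ∈ range (n - 1), FreeAbelianGroup.of (s, ((j + 1 : ℕ) : ℚ) * s)) := by
  obtain ⟨m, rfl⟩ : ∃ m, n = m + 1 := ⟨n - 1, by omega⟩
  rw [Nat.add_sub_cancel, map_sum, map_sum]
  simp only [Phi_of]
  have hm1 : (0 : ℕ) < m + 1 := Nat.succ_pos m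
  -- left-hand side pieces
  have hA : ∑ k ∈ range m, chi ((((k + 1 : ℕ) : ℚ)) / ((m + 1 : ℕ) : ℚ)) = 0 := by
    have h := sum_chi_div_zero (m + 1) hm1
    rw [sum_range_succ'] at h
    simpa using h
  have hB : ∑ k ∈ range m, chi ((((k + 1 : ℕ) : ℚ)) / ((m + 1 : ℕ) : ℚ) + s) =
      chi (((m + 1 : ℕ) : ℚ) * s) + chi s := by
    have h := sum_chi_add_div (m + 1) hm1 s
    rw [sum_range_succ'] at h
    simp only [Nat.cast_zero, zero_div, add_zero] at h
    have h' : ∑ k ∈ range m, chi ((((k + 1 : ℕ) : ℚ)) / ((m + 1 : ℕ) : ℚ) + s) =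
        ∑ k ∈ range m, chi (s + (((k + 1 : ℕ) : ℚ)) / ((m + 1 : ℕ) : ℚ)) :=
      sum_congr rfl fun k _ => by rw [add_comm]
    rw [h']
    linear_combination h - CharTwo.add_self_eq_zero (chi s)
  -- right-hand side piece: telescoping
  have hC : ∑ j ∈ range m, chi (((j + 1 : ℕ) : ℚ) * s) +
      ∑ j ∈ range m, chi (s + ((j + 1 : ℕ) : ℚ) * s) =
      chi s + chi (((m + 1 : ℕ) : ℚ) * s) := by
    rw [← sum_add_distrib]
    have h := sum_add_succ_zmod_two (fun j => chi (((j + 1 : ℕ) : ℚ) * s)) m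
    simp only [zero_add, Nat.cast_one, one_mul] at h
    rw [← h]
    refine sum_congr rfl fun j _ => ?_
    congr 2
    push_cast
    ring
  have hL : ∑ k ∈ range m, (chi ((((k + 1 : ℕ) : ℚ)) / ((m + 1 : ℕ) : ℚ)) + chi s +
      chi ((((k + 1 : ℕ) : ℚ)) / ((m + 1 : ℕ) : ℚ) + s)) =
      ∑ k ∈ range m, chi s + (chi (((m + 1 : ℕ) : ℚ) * s) + chi s) := by
    rw [sum_add_distrib, sum_add_distrib, hA, hB, zero_add]
  have hR : ∑ j ∈ range m, (chi s + chi (((j + 1 : ℕ) : ℚ) * s) +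
      chi (s + ((j + 1 : ℕ) : ℚ) * s)) =
      ∑ j ∈ range m, chi s + (chi s + chi (((m + 1 : ℕ) : ℚ) * s)) := by
    rw [sum_add_distrib, sum_add_distrib, add_assoc, hC]
  rw [hL, hR]
  abel

/-- The level-12 gap symbol `g₁₂ = [1/12,1/4] − [1/4,1/4]` is killed by `Φ`. [folklore] -/
theorem Phi_g12 :
    Phi (FreeAbelianGroup.of (((1:ℚ)/12), ((1:ℚ)/4)) -
      FreeAbelianGroup.of (((1:ℚ)/4), ((1:ℚ)/4))) = 0 := by
  rw [map_sub, Phi_of, Phi_of]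
  have h1 : ((1:ℚ)/12).den = 12 := by norm_num
  have h2 : ((1:ℚ)/4).den = 4 := by norm_num
  have h3 : ((1:ℚ)/12 + (1:ℚ)/4) = (1:ℚ)/3 := by norm_num
  have h4 : ((1:ℚ)/3).den = 3 := by norm_num
  have h5 : ((1:ℚ)/4 + (1:ℚ)/4) = (1:ℚ)/2 := by norm_num
  have h6 : ((1:ℚ)/2).den = 2 := by norm_num
  simp only [h3, h5, chi_eq, h1, h2, h4, h6]
  decide

/-- `Φ` of Das's level-15 symbol `[4/15,1/5] − [1/3,2/15]` is `1`. [folklore] -/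
theorem Phi_das :
    Phi (FreeAbelianGroup.of (((4:ℚ)/15), ((1:ℚ)/5)) -
      FreeAbelianGroup.of (((1:ℚ)/3), ((2:ℚ)/15))) = 1 := by
  rw [map_sub, Phi_of, Phi_of]
  have h1 : ((4:ℚ)/15).den = 15 := by norm_num
  have h2 : ((1:ℚ)/5).den = 5 := by norm_num
  have h3 : ((4:ℚ)/15 + (1:ℚ)/5) = (7:ℚ)/15 := by norm_num
  have h4 : ((7:ℚ)/15).den = 15 := by norm_num
  have h5 : ((1:ℚ)/3).den = 3 := by norm_num
  have h6 : ((2:ℚ)/15).den = 15 := by norm_num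
  have h7 : ((1:ℚ)/3 + (2:ℚ)/15) = (7:ℚ)/15 := by norm_num
  simp only [h3, h7, chi_eq, h1, h2, h4, h5, h6]
  decide

/-! ### The standard relator span lies in the kernel of `Phi` -/

/-- **`RelSpan ⊔ ℤ·g₁₂ ≤ ker Φ`.** The subgroup of `ℤ[ℚ × ℚ]` generated by the six standard relator
families of the item `GapSectorBeyondTwelve` (symmetry, translation, Dirichlet re-association,
Gauss multiplication for every `n ≥ 2`, Euler reflection, unit — the set is copied VERBATIM from
the route file), joined with the multiples of the level-12 gap symbol `g₁₂`, is killed by the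
parity functional `Φ`. [folklore] -/
theorem relSpan_sup_le_ker :
    AddSubgroup.closure ((fun p : Multiset (ℚ × ℚ) × Multiset (ℚ × ℚ) =>
        (p.1.map fun q : ℚ × ℚ => FreeAbelianGroup.of (q.1, q.2)).sum -
        (p.2.map fun q : ℚ × ℚ => FreeAbelianGroup.of (q.1, q.2)).sum) ''
      ({p : Multiset (ℚ × ℚ) × Multiset (ℚ × ℚ) | ∃ a b : ℚ, 0 < a ∧ 0 < b ∧ p = ({(a, b)}, {(b, a)})} ∪
       {p | ∃ a b : ℚ, 0 < a ∧ 0 < b ∧ p = ({(a, b)}, {(a + 1, b)})} ∪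
       {p | ∃ a b c : ℚ, 0 < a ∧ 0 < b ∧ 0 < c ∧
          p = ({(a, b), (a + b, c)}, {(b, c), (a, b + c)})} ∪
       {p | ∃ (n : ℕ) (s : ℚ), 2 ≤ n ∧ 0 < s ∧
          p = ((Finset.range (n - 1)).val.map fun k => ((((k + 1 : ℕ) : ℚ)) / n, s),
               (Finset.range (n - 1)).val.map fun j => (s, ((j + 1 : ℕ) : ℚ) * s))} ∪
       {p | ∃ a : ℚ, 0 < a ∧ a < 1 ∧ p = ({(a, 1 - a)}, {(1 / 2, 1 / 2)})} ∪
       {({((1 : ℚ), (1 : ℚ))}, 0)})) ⊔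
    AddSubgroup.zmultiples (FreeAbelianGroup.of (((1:ℚ)/12), ((1:ℚ)/4)) -
      FreeAbelianGroup.of (((1:ℚ)/4), ((1:ℚ)/4))) ≤ Phi.ker := by
  refine sup_le ?_ ?_
  · rw [AddSubgroup.closure_le]
    rintro _ ⟨p, hp, rfl⟩
    simp only [SetLike.mem_coe, AddMonoidHom.mem_ker, map_sub]
    rcases hp with ((((h | h) | h) | h) | h) | h
    · obtain ⟨a, b, -, -, rfl⟩ := h
      simp only [Multiset.map_singleton, Multiset.sum_singleton]
      rw [Phi_symm, sub_self]
    · obtain ⟨a, b, -, -, rfl⟩ := h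
      simp only [Multiset.map_singleton, Multiset.sum_singleton]
      rw [Phi_transl, sub_self]
    · obtain ⟨a, b, c, -, -, -, rfl⟩ := h
      simp only [Multiset.insert_eq_cons, Multiset.map_cons, Multiset.map_singleton,
        Multiset.sum_cons, Multiset.sum_singleton, map_add]
      rw [Phi_dirichlet, sub_self]
    · obtain ⟨n, s, hn, -, rfl⟩ := h
      simp only [Multiset.map_map, Function.comp_def]
      rw [← Finset.sum_eq_multiset_sum, ← Finset.sum_eq_multiset_sum,
        Phi_gauss n (by omega) s, sub_self]
    · obtain ⟨a, -, -, rfl⟩ := h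
      simp only [Multiset.map_singleton, Multiset.sum_singleton]
      rw [Phi_refl, sub_self]
    · rw [Set.mem_singleton_iff] at h
      subst h
      simp only [Multiset.map_singleton, Multiset.sum_singleton, Multiset.map_zero,
        Multiset.sum_zero, map_zero, sub_zero]
      exact Phi_unit
  · rw [AddSubgroup.zmultiples_le, AddMonoidHom.mem_ker]
    exact Phi_g12

/-- **Das's level-15 symbol is outside `RelSpan ⊔ ℤ·g₁₂`** (at ALL levels at once):
`[4/15,1/5] − [1/3,2/15] ∉ closure(relator pairs) ⊔ ℤ·g₁₂`, because `Φ` kills the right-hand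
side and takes the value `1` on the symbol. [folklore] -/
theorem das_symbol_not_mem :
    FreeAbelianGroup.of (((4:ℚ)/15), ((1:ℚ)/5)) - FreeAbelianGroup.of (((1:ℚ)/3), ((2:ℚ)/15)) ∉
    AddSubgroup.closure ((fun p : Multiset (ℚ × ℚ) × Multiset (ℚ × ℚ) =>
        (p.1.map fun q : ℚ × ℚ => FreeAbelianGroup.of (q.1, q.2)).sum -
        (p.2.map fun q : ℚ × ℚ => FreeAbelianGroup.of (q.1, q.2)).sum) ''
      ({p : Multiset (ℚ × ℚ) × Multiset (ℚ × ℚ) | ∃ a b : ℚ, 0 < a ∧ 0 < b ∧ p = ({(a, b)}, {(b, a)})} ∪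
       {p | ∃ a b : ℚ, 0 < a ∧ 0 < b ∧ p = ({(a, b)}, {(a + 1, b)})} ∪
       {p | ∃ a b c : ℚ, 0 < a ∧ 0 < b ∧ 0 < c ∧
          p = ({(a, b), (a + b, c)}, {(b, c), (a, b + c)})} ∪
       {p | ∃ (n : ℕ) (s : ℚ), 2 ≤ n ∧ 0 < s ∧
          p = ((Finset.range (n - 1)).val.map fun k => ((((k + 1 : ℕ) : ℚ)) / n, s),
               (Finset.range (n - 1)).val.map fun j => (s, ((j + 1 : ℕ) : ℚ) * s))} ∪
       {p | ∃ a : ℚ, 0 < a ∧ a < 1 ∧ p = ({(a, 1 - a)}, {(1 / 2, 1 / 2)})} ∪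
       {({((1 : ℚ), (1 : ℚ))}, 0)})) ⊔
    AddSubgroup.zmultiples (FreeAbelianGroup.of (((1:ℚ)/12), ((1:ℚ)/4)) -
      FreeAbelianGroup.of (((1:ℚ)/4), ((1:ℚ)/4))) := fun h => by
  have h1 := relSpan_sup_le_ker h
  rw [AddMonoidHom.mem_ker, Phi_das] at h1
  exact one_ne_zero h1

/-! ### Arithmetic of the Das pair -/

/-- `{u · a/d} = (u a mod d)/d` for naturals. [folklore] -/
theorem fract_natCast_mul_div (u a d : ℕ) :
    Int.fract ((u : ℚ) * ((a : ℚ) / (d : ℚ))) = (((u * a) % d : ℕ) : ℚ) / (d : ℚ) := by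
  rw [show (u : ℚ) * ((a : ℚ) / (d : ℚ)) = ((u * a : ℕ) : ℚ) / (d : ℚ) by push_cast; ring]
  exact Int.fract_div_natCast_eq_div_natCast_mod

/-- **The Hodge-type test for Das's pair** `B(4/15,1/5)` versus `B(1/3,2/15)` (weight `k = 0`):
for every `u` coprime to `15`, `{4u/15} + {u/5} − {7u/15} = {u/3} + {2u/15} − {7u/15}`
(both CM types are `{1,2,4,8} ⊂ (ℤ/15)ˣ`; a finite check on `u mod 15`). [folklore] -/
theorem das_hodge (u : ℕ) (hu : Nat.Coprime u 15) :
    Int.fract ((u : ℚ) * ((4:ℚ)/15)) + Int.fract ((u : ℚ) * ((1:ℚ)/5)) -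
        Int.fract ((u : ℚ) * ((4:ℚ)/15 + (1:ℚ)/5)) -
      (Int.fract ((u : ℚ) * ((1:ℚ)/3)) + Int.fract ((u : ℚ) * ((2:ℚ)/15)) -
        Int.fract ((u : ℚ) * ((1:ℚ)/3 + (2:ℚ)/15))) = 0 := by
  rw [show ((4:ℚ)/15 + (1:ℚ)/5) = ((1:ℚ)/3 + (2:ℚ)/15) by norm_num]
  have f1 := fract_natCast_mul_div u 4 15
  have f2 := fract_natCast_mul_div u 1 5
  have f3 := fract_natCast_mul_div u 1 3
  have f4 := fract_natCast_mul_div u 2 15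
  simp only [Nat.cast_ofNat, Nat.cast_one, mul_one] at f1 f2 f3 f4
  rw [f1, f2, f3, f4]
  have hr15 : u % 15 < 15 := Nat.mod_lt _ (by norm_num)
  have hg : Nat.gcd (u % 15) 15 = 1 := by
    rw [← Nat.gcd_rec]
    exact Nat.Coprime.gcd_eq_one hu.symm
  have key : ∀ r, r < 15 → Nat.gcd r 15 = 1 →
      (r * 4) % 15 + 3 * (r % 5) = 5 * (r % 3) + (r * 2) % 15 := by decide
  have hN := key (u % 15) hr15 hg
  rw [Nat.mod_mod_of_dvd u (by norm_num : 5 ∣ 15), Nat.mod_mod_of_dvd u (by norm_num : 3 ∣ 15)]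
    at hN
  have e4 : (u * 4) % 15 = (u % 15 * 4) % 15 := by rw [Nat.mul_mod]
  have e2 : (u * 2) % 15 = (u % 15 * 2) % 15 := by rw [Nat.mul_mod]
  rw [← e4, ← e2] at hN
  have hQ : (((u * 4 % 15 : ℕ)) : ℚ) + 3 * ((u % 5 : ℕ) : ℚ) =
      5 * ((u % 3 : ℕ) : ℚ) + ((u * 2 % 15 : ℕ) : ℚ) := by exact_mod_cast hN
  linear_combination (1/15 : ℚ) * hQ

end Summit.KontsevichZagierPeriods.TerasomaMultiplication.GapSectorBeyondTwelveParity

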